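import Summits.SmoothPoincare4.SmoothPoincare4.Theorems.SullivanDualHyperbolicEndTaubesModelDefs

/-!
# Route `SullivanDual`, crux `HyperbolicEnd` (stmt-SmoothPoincare4-7825), line `taubes-circle-pencil`:
# smoothness of Taubes' model form `ωT` and of the singular structure `J♭` off the core

Registered helpers `helper_taubesForm_contDiffAt` and `helper_taubesJ_contDiffAt` of the checked
skeleton: for `0 < δ < 1` and `y` in the flat Taubes tube `taubesTube δ`,

* `(y, v, w) ↦ taubesForm y v w` is jointly `C^∞` at `(y, v, w)` (Taubes, Geom. Topol. 2 (1998),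
  §1: `ωT = dt ∧ dQ + ⋆₃ dQ` is a smooth form on the whole solid torus, across the core circle);
* if moreover `y ∉ taubesCore`, `(y, u) ↦ taubesJ y u` is jointly `C^∞` at `(y, u)` (Taubes 1998,
  §1: `J♭ = (a J₁ + b J₂ − 2c J₃)/|∇Q|` is smooth off the zero circle `{|∇Q| = 0}`).

Method.  The explicit formulas of `Theorems/SullivanDualHyperbolicEndTaubesModelDefs.lean` are
rational expressions in the flat coordinates of `y, u, v, w`, in `r = taubesR y = √(y₀² + y₁²)` and
(for `J♭`) in `|∇Q| = taubesGrad y = √((r − 1)² + y₂² + 4y₃²)`, with denominators `r`, `r²`,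
`|∇Q|`.  On a tube of radius `δ < 1` one has `r > 0` (the tube misses the axis `y₀ = y₁ = 0`), and
off the core circle `|∇Q| > 0` (if `(r − 1)² + y₂² + 4y₃² = 0` then `r = 1`, `y₂ = y₃ = 0`, i.e.
`y₀² + y₁² = 1`: the point is on the core).  Hence both radicands are positive, `√` is smooth
there (`ContDiffAt.sqrt`), the denominators do not vanish (`ContDiffAt.div`), and the coordinate
projections of `ℝ⁴ = EuclideanSpace ℝ (Fin 4)` and of the product are smooth; Mathlib's
`fun_prop` assembles the composite, the non-vanishing side conditions being discharged by
`assumption`.  For the `ℝ⁴`-valued `J♭` smoothness is checked coordinatewise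
(`contDiffAt_euclidean`).
-/

-- the registered namespace `Summit.SmoothPoincare4.SmoothPoincare4.…` repeats a component (P = Sub)
set_option linter.dupNamespace false

open scoped ContDiff

namespace Summit.SmoothPoincare4.SmoothPoincare4.Cruxes.HyperbolicEnd.TaubesCirclePencil

/-! ### Non-vanishing of the radicands and denominators -/

/-- On a tube of radius `< 1` the point is off the axis: `y₀² + y₁² ≠ 0` (so `√` is smooth at the
radicand of `r`). Private copy of the positivity `0 < taubesR y` of the sibling identities file,
in the form consumed by `ContDiffAt.sqrt`. [folklore] -/
private theorem smooth_radicand_ne_zero (δ : ℝ) (y : EuclideanSpace ℝ (Fin 4)) (hδ0 : 0 < δ)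
    (hδ : δ < 1) (hy : y ∈ taubesTube δ) : y 0 ^ 2 + y 1 ^ 2 ≠ 0 := by
  rw [mem_taubesTube, taubesR] at hy
  intro h
  rw [h, Real.sqrt_zero] at hy
  nlinarith [sq_nonneg (y 2), sq_nonneg (y 3), hy, hδ0, hδ]

/-- On a tube of radius `< 1`, `r = taubesR y ≠ 0`. [folklore] -/
private theorem smooth_taubesR_ne_zero (δ : ℝ) (y : EuclideanSpace ℝ (Fin 4)) (hδ0 : 0 < δ)
    (hδ : δ < 1) (hy : y ∈ taubesTube δ) : taubesR y ≠ 0 := by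
  rw [taubesR, Real.sqrt_ne_zero (add_nonneg (sq_nonneg _) (sq_nonneg _))]
  exact smooth_radicand_ne_zero δ y hδ0 hδ hy

/-- Off the core circle the radicand of `|∇Q|` does not vanish: `(r − 1)² + y₂² + 4y₃² ≠ 0`
(if it vanished, `r = 1` and `y₂ = y₃ = 0`, so `y₀² + y₁² = r² = 1` and `y ∈ taubesCore`; no tube
hypothesis is needed). [folklore] -/
private theorem smooth_gradRadicand_ne_zero (y : EuclideanSpace ℝ (Fin 4)) (hc : y ∉ taubesCore) :
    (taubesR y - 1) ^ 2 + y 2 ^ 2 + 4 * y 3 ^ 2 ≠ 0 := by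
  intro h
  have ha := sq_nonneg (taubesR y - 1)
  have hb := sq_nonneg (y 2)
  have hc' := sq_nonneg (y 3)
  have hr : taubesR y = 1 := sub_eq_zero.1 ((pow_eq_zero_iff two_ne_zero).1 (by linarith))
  have hy2 : y 2 = 0 := (pow_eq_zero_iff two_ne_zero).1 (by linarith)
  have hy3 : y 3 = 0 := (pow_eq_zero_iff two_ne_zero).1 (by linarith)
  have hs := Real.sq_sqrt (add_nonneg (sq_nonneg (y 0)) (sq_nonneg (y 1)))
  rw [← taubesR, hr, one_pow] at hs
  exact hc (mem_taubesCore.2 ⟨hs.symm, hy2, hy3⟩)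

/-- Off the core circle, `|∇Q| = taubesGrad y ≠ 0`. [folklore] -/
private theorem smooth_taubesGrad_ne_zero (y : EuclideanSpace ℝ (Fin 4)) (hc : y ∉ taubesCore) :
    taubesGrad y ≠ 0 := by
  rw [taubesGrad, Real.sqrt_ne_zero (by positivity)]
  exact smooth_gradRadicand_ne_zero y hc

/-! ### Smoothness of `ωT` on the tube -/

/-- **`ωT` is smooth on the Taubes tube, jointly in the point and the two vectors** (Taubes 1998,
§1): for `0 < δ < 1` and `y ∈ taubesTube δ`, the map `(y, v, w) ↦ taubesForm y v w` on
`ℝ⁴ × ℝ⁴ × ℝ⁴` is `C^∞` at `(y, v, w)` — every block `r = √(y₀² + y₁²)`, `dt`, `da`, `dQ` of the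
explicit formula is smooth off the axis `{r = 0}`, which the tube misses. [folklore] -/
theorem helper_taubesForm_contDiffAt : ∀ (δ : ℝ) (y : EuclideanSpace ℝ (Fin 4)), 0 < δ → δ < 1 → y ∈ taubesTube δ → ∀ v w : EuclideanSpace ℝ (Fin 4), ContDiffAt ℝ ∞ (fun q : EuclideanSpace ℝ (Fin 4) × EuclideanSpace ℝ (Fin 4) × EuclideanSpace ℝ (Fin 4) => taubesForm q.1 q.2.1 q.2.2) (y, v, w) := by
  intro δ y hδ0 hδ hy v w
  have hN : y 0 ^ 2 + y 1 ^ 2 ≠ 0 := smooth_radicand_ne_zero δ y hδ0 hδ hy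
  have hr : taubesR y ≠ 0 := smooth_taubesR_ne_zero δ y hδ0 hδ hy
  have hr2 : taubesR y ^ 2 ≠ 0 := pow_ne_zero 2 hr
  unfold taubesForm taubesDt taubesDQ taubesDa taubesR
  fun_prop (disch := assumption)

/-! ### Smoothness of `J♭` on the punctured tube -/

/-- **`J♭` is smooth on the Taubes tube off the core circle, jointly in the point and the vector**
(Taubes 1998, §1: `J♭ = (a J₁ + b J₂ − 2c J₃)/|∇Q|` is singular exactly along `{|∇Q| = 0}`, the
core): for `0 < δ < 1`, `y ∈ taubesTube δ`, `y ∉ taubesCore`, the map `(y, u) ↦ taubesJ y u` on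
`ℝ⁴ × ℝ⁴` is `C^∞` at `(y, u)` — each flat component of the explicit formula is a rational
expression in the coordinates, `r = √(y₀² + y₁²) > 0` and `|∇Q| = √((r − 1)² + y₂² + 4y₃²) > 0`.
[folklore] -/
theorem helper_taubesJ_contDiffAt : ∀ (δ : ℝ) (y : EuclideanSpace ℝ (Fin 4)), 0 < δ → δ < 1 → y ∈ taubesTube δ → y ∉ taubesCore → ∀ u : EuclideanSpace ℝ (Fin 4), ContDiffAt ℝ ∞ (fun q : EuclideanSpace ℝ (Fin 4) × EuclideanSpace ℝ (Fin 4) => taubesJ q.1 q.2) (y, u) := by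
  intro δ y hδ0 hδ hy hc u
  have hN : y 0 ^ 2 + y 1 ^ 2 ≠ 0 := smooth_radicand_ne_zero δ y hδ0 hδ hy
  have hr : taubesR y ≠ 0 := smooth_taubesR_ne_zero δ y hδ0 hδ hy
  have hr2 : taubesR y ^ 2 ≠ 0 := pow_ne_zero 2 hr
  have hG : (taubesR y - 1) ^ 2 + y 2 ^ 2 + 4 * y 3 ^ 2 ≠ 0 := smooth_gradRadicand_ne_zero y hc
  have hg : taubesGrad y ≠ 0 := smooth_taubesGrad_ne_zero y hc
  -- coordinatewise: the four flat components `![E…] 0, …, ![E…] 3` of `J♭ u`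
  rw [contDiffAt_euclidean, Fin.forall_fin_succ, Fin.forall_fin_succ, Fin.forall_fin_succ,
    Fin.forall_fin_one]
  simp only [taubesJ, WithLp.ofLp_toLp, Matrix.cons_val_zero, Matrix.cons_val_succ]
  unfold taubesGrad taubesDt taubesDa taubesR
  refine ⟨?_, ?_, ?_, ?_⟩ <;> fun_prop (disch := assumption)

end Summit.SmoothPoincare4.SmoothPoincare4.Cruxes.HyperbolicEnd.TaubesCirclePencil
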